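/-
Copyright (c) 2026 the pub-hodgecm-mathlib formalisation cell (harness21).  Prover seat hodgecm-mathlib-LH3-p02 (g3) on line LH3 (closer stub `stub_N9`, N9 «Transf» direct
road), organ J, the `G′`-SIDE ASSEMBLY of (J-G′-JUMP) (LH3-plan (g3) RULINGS #6 (c) «final assembly», #9 (B-STD)); 2026-09-02.
-/
import Literature.NumberTheory.Rogawski1990.ArchOrbFamGExtJumpSide                    -- ★ p850413∕p850441∕p850473 (this seat): the (JG′) heads, §5 (c-jump) over the shared datum; brings ★ p850353 (`U(J)`, `P`, `cayley_conj_circleDiagonal_mem_of_eq_over`)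
import Literature.NumberTheory.Automorphic.ArchRankOneBlockStandardise                 -- ★ p850476∕p850488 (F0P3a-p07 (g16)) (B-STD): `exists_continuousMulEquiv_prod_std` (`φ`, `e′`, torus∕value clauses)
import Literature.NumberTheory.Automorphic.ArchInnerFormSemiregularCentralizerQuotient  -- ★ p850477 (LH5-p02 (g3)) (M-UNFOLD) PART 2: `exists_quotient_homeomorph_of_map_eq_prod_top`; brings ★ p850446 PART 1 `exists_continuousMulEquiv_centralizer_gprimeTorus_semireg`
import HarnessLib

/-!
# The `G′`-side assembly of organ J, part 1: the STANDARDISED block package at a semi-regular wall point — `e′ : Z(γ_p) ≃ₜ* U(J) × K`, `Ψ′ : Z(γ_p) ⧸ T′ ≃ₜ U(J) ⧸ A_J`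
# ((M-UNFOLD) ★ p850446∕p850477 composed with (B-STD) ★ p850476∕p850488; Rogawski 1990 §4.12, §8.2 p. 122)

Topic `NumberTheory/Rogawski1990`; namespace `Literature.NumberTheory.Rogawski1990`.  THEOREMS ONLY (no definition, no instance, no notation, no axiom, no named fact, no `sorry`);
kernel lane `--kind proof --supports stmt-HodgeConjecture-24833`.  Cell `pub/hodgecm-mathlib` (D-0151), crux H413 = `stmt-HodgeConjecture-24833`, F0∕P3c line LH3 (closer stub
`stub_N9`, DIRECT ROAD, organ J): the ∀-proof of the `G′`-SIDE HEAD `hG` of ★ `jumpBricks_of_sides_std` (p850463) instantiates, per wall point, the α-side block package ★ p850417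
`exists_block_testFunction_chartOrbG_eventuallyEq` at the STANDARD rank-one group `B := U(J)` (RULINGS #8∕#9: so that the rank-one jump is read against the SHARED `(μ₀, C₁)`), which
needs ONE block equivalence `eM : Z(γ_p) ≃ₜ* U(J) × K`, ONE quotient homeomorphism `Ψ : Z(γ_p) ⧸ T′ ≃ₜ U(J) ⧸ A` with `Ψ⁻¹⟦b⟧ = ⟦eM⁻¹(b,1)⟧`, and the torus bookkeeping.  ★ (M-UNFOLD)
delivers these for the DIAGONAL-form block `B_w = U(σ_w diag(α_{τ0}, α_{τ2}))(ℂ)`; ★ (B-STD) delivers `φ : B_w ≃ₜ* U(J)` and the composite `e′ = (φ × id) ∘ e` abstractly.  This file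
packages the composition ONCE, with the clauses every downstream hand binds:

* §1 `map_prodMap_eq_of_map_eq_prod_top` (generic): `e(T) = A × ⊤` and `e′ = (φ × id) ∘ e` ⇒ `e′(T) = φ(A) × ⊤`; `mem_iff_fst_mem_of_map_eq_prod_top`: `e′(T) = A × ⊤ ⇒ (g ∈ T ↔ (e′ g).1 ∈ A)`;
* §2 **`exists_block_std_semireg`** — at a semi-regular chart point of the compact chart `S` (`w₀ ∉ S` a split-chart place): `∃ K e φ e′ Ψ′` with ★ PART 1's clauses [1]–[7] for `e`,
  (B-STD)'s torus clause (i) and value clause for `φ`, `he′ : ∀ g, e′ g = (φ (e g).1, (e g).2)`, **`e′(T′) = A_J × ⊤`** with `A_J := φ(A_w)` the Cayley torus of `U(J)`,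
  **`Ψ′ ⟦g⟧ = ⟦(e′ g).1⟧`, `Ψ′⁻¹ ⟦b⟧ = ⟦e′⁻¹ (b, 1)⟧`** (★ PART 2's generic lemma at `e′`), the membership reading **`g ∈ T′ ↔ (e′ g).1 ∈ A_J`**, and `IsCompact A_J`;
* §3 (ED. 2) **`exists_std_package`** — the same package IN BINDER FORM over ANY `e : G ≃ₜ* B_{w₀} × K`, `T ≤ G`, `A ≤ B_{w₀}` with `e(T) = A × ⊤` (so ONE `e′` serves every ★
  (M-UNFOLD) edition — ★ p850446, ★ p850544 [5β]∕[6β], the Cayley [7β] — and both tori `T′`, `T♯′`); `isCompact_map_circleDiagonal_range`.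
HONEST LABEL: HC_CM is proved only modulo the 7 printed citations (2 remaining: hLiu418 = `stmt-HodgeConjecture-24832`, h413 = `stmt-HodgeConjecture-24833`) until rung 0 closes;
count-neutral plumbing (no analysis).

## References
* [Rogawski1990] J. D. Rogawski, *Automorphic Representations of Unitary Groups in Three Variables*, Ann. of Math. Stud. 123 (1990), §4.12 Lemma 4.12.1 p. 66, §8.2 p. 122.
* [Folland1995] G. B. Folland, *A Course in Abstract Harmonic Analysis* (1995), §2.6.
* [PlatonovRapinchuk1994] V. Platonov, A. Rapinchuk, *Algebraic Groups and Number Theory* (1994), §2.3.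
-/

set_option autoImplicit false

noncomputable section

open MeasureTheory MeasureTheory.Measure NumberField NumberField.InfinitePlace Matrix Complex Set Filter Topology
open scoped MatrixGroups Matrix Real Classical
open Literature.NumberTheory.Automorphic Literature.NumberTheory.Automorphic.UnitaryGroup Literature.NumberTheory.Automorphic.ArchCartan
open Literature.NumberTheory.Automorphic.Shelstad1979.StableOrbitalIntegrals
open Literature.NumberTheory.GaloisRepresentations Literature.MeasureTheory.Group

namespace Literature.NumberTheory.Rogawski1990

/-! ## §1 Generic: pushing `e(T) = A × ⊤` through `φ × id` -/

section Generic

variable {G B U K : Type*} [Group G] [Group B] [Group U] [Group K]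
  [TopologicalSpace G] [TopologicalSpace B] [TopologicalSpace U] [TopologicalSpace K]

/-- **`e(T) = A × ⊤` and `e′ = (φ × id) ∘ e` give `e′(T) = φ(A) × ⊤`.** [cite: Folland1995, §2.6] -/
theorem map_prodMap_eq_of_map_eq_prod_top (T : Subgroup G) (A : Subgroup B) (e : G ≃ₜ* B × K) (φ : B ≃ₜ* U) (e' : G ≃ₜ* U × K)
    (he' : ∀ g, e' g = (φ (e g).1, (e g).2)) (hT : Subgroup.map (e : G →* B × K) T = A.prod ⊤) :
    Subgroup.map (e' : G →* U × K) T = (Subgroup.map (φ : B →* U) A).prod ⊤ := by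
  ext x
  constructor
  · rintro ⟨g, hg, rfl⟩
    have hmem : (e : G →* B × K) g ∈ A.prod ⊤ := hT ▸ ⟨g, hg, rfl⟩
    refine ⟨⟨(e g).1, hmem.1, ?_⟩, Subgroup.mem_top _⟩
    show φ (e g).1 = (e' g).1
    rw [he' g]
  · rintro ⟨⟨a, ha, hax⟩, -⟩
    have hmem : ((a, x.2) : B × K) ∈ A.prod ⊤ := ⟨ha, Subgroup.mem_top _⟩
    rw [← hT] at hmem
    obtain ⟨g, hg, hge⟩ := hmem
    refine ⟨g, hg, ?_⟩
    show e' g = x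
    rw [he' g]
    have hge' : e g = (a, x.2) := hge
    rw [hge']
    exact Prod.ext hax rfl

/-- Membership reading: `e′(T) = A × ⊤` gives `g ∈ T ↔ (e′ g).1 ∈ A`. [cite: Folland1995, §2.6] -/
theorem mem_iff_fst_mem_of_map_eq_prod_top (T : Subgroup G) (A : Subgroup U) (e' : G ≃ₜ* U × K)
    (hT : Subgroup.map (e' : G →* U × K) T = A.prod ⊤) (g : G) : g ∈ T ↔ (e' g).1 ∈ A := by
  constructor
  · intro hg
    have h : (e' : G →* U × K) g ∈ Subgroup.map (e' : G →* U × K) T := ⟨g, hg, rfl⟩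
    rw [hT] at h
    exact h.1
  · intro hg
    have h : ((e' : G →* U × K) g) ∈ (A.prod ⊤ : Subgroup (U × K)) := ⟨hg, Subgroup.mem_top _⟩
    rw [← hT] at h
    obtain ⟨g', hg', hgg'⟩ := h
    have : g' = g := e'.injective hgg'
    exact this ▸ hg'

end Generic

/-! ## §2 The standardised block package at a semi-regular point of the compact chart -/

section Std

variable (L : Type) [Field L] [NumberField L] [IsCMField L] (α : Fin 3 → L)
  (S : Finset {w : InfinitePlace L // IsComplex w}) (w₀ : {w : InfinitePlace L // IsComplex w})
  {J : Matrix (Fin 2) (Fin 2) ℂ} (hJ : J = (StdForm.antidiagonal 2).over ℂ)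

omit [NumberField L] [IsCMField L] in
/-- **The (B-STD) frame hypotheses at a split-chart place**: the two block weights `σ_{w₀}(α_{τ0})`, `σ_{w₀}(α_{τ2})` are real of opposite signs (★ `splitChartPlaces`).
[cite: Rogawski1990, §3.6 p. 31] -/
theorem blockWeights_of_mem_splitChartPlaces (hwsp : w₀ ∈ splitChartPlaces L α) :
    (∀ i : Fin 2, (w₀.1.embedding (![α (lineOf (formSign L α w₀) 0), α (lineOf (formSign L α w₀) 2)] i)).im = 0) ∧
      (w₀.1.embedding (![α (lineOf (formSign L α w₀) 0), α (lineOf (formSign L α w₀) 2)] 0)).re *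
        (w₀.1.embedding (![α (lineOf (formSign L α w₀) 0), α (lineOf (formSign L α w₀) 2)] 1)).re < 0 := by
  refine ⟨fun i => ?_, ?_⟩
  · fin_cases i
    · exact hwsp.1 _
    · exact hwsp.1 _
  · have h := hwsp.2
    simp only [formRe] at h
    simpa using h

/-- **(M-UNFOLD) ∘ (B-STD): THE STANDARDISED BLOCK PACKAGE at a semi-regular point `p` of the compact chart `S` at a SPLIT-CHART place `w₀ ∉ S`.**  There are a closed commutative
`K ≤ Z(γ_p)` (inside `T′ = chartTorusG S`), the (M-UNFOLD) block equivalence `e : Z(γ_p) ≃ₜ* B_{w₀} × K` with its clauses [4]–[7] (★ p850446), the (B-STD) standardisation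
`φ : B_{w₀} ≃ₜ* U(J)` with its torus clause `φ(diag u) = P·diag(u)·P⁻¹` and value formula (★ p850476), the composite **`e′ : Z(γ_p) ≃ₜ* U(J) × K`, `e′ g = (φ (e g).1, (e g).2)`**
(★ p850488), and a quotient homeomorphism **`Ψ′ : Z(γ_p) ⧸ T′ ≃ₜ U(J) ⧸ A_J`**, `A_J := φ(A_{w₀})` the Cayley torus of `U(J)` (`A_{w₀}` = the unit-diagonal torus of `B_{w₀}`), with
`Ψ′⟦g⟧ = ⟦(e′ g).1⟧`, **`Ψ′⁻¹⟦b⟧ = ⟦e′⁻¹(b, 1)⟧`** (the `hΨ` binder of ★ p850417 at `B := U(J)`), `e′(T′) = A_J × ⊤`, `g ∈ T′ ↔ (e′ g).1 ∈ A_J`, and `A_J` compact.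
[cite: Rogawski1990, §4.12 Lemma 4.12.1 p. 66; §8.2 p. 122] [cite: Folland1995, §2.6] [cite: PlatonovRapinchuk1994, §2.3] -/
theorem exists_block_std_semireg (hα : ∀ i, α i ≠ 0) (hS : ∀ w, w ∈ S → w ∈ splitChartPlaces L α)
    (hw₀ : w₀ ∉ S)
    (hreal2 : ∀ i : Fin 2, (w₀.1.embedding (![α (lineOf (formSign L α w₀) 0), α (lineOf (formSign L α w₀) 2)] i)).im = 0)
    (hsgn : (w₀.1.embedding (![α (lineOf (formSign L α w₀) 0), α (lineOf (formSign L α w₀) 2)] 0)).re *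
      (w₀.1.embedding (![α (lineOf (formSign L α w₀) 0), α (lineOf (formSign L α w₀) 2)] 1)).re < 0)
    (p : {w : InfinitePlace L // IsComplex w} → Fin 3 → ℝ)
    (h02 : Circle.exp (p w₀ 0) = Circle.exp (p w₀ 2)) (h01 : Circle.exp (p w₀ 0) ≠ Circle.exp (p w₀ 1))
    (hreg : ∀ w, w ≠ w₀ → w ∉ S → Function.Injective fun i : Fin 3 => Circle.exp (p w i)) (hregS : ∀ w, w ∈ S → p w 0 ≠ 0) :
    ∃ (K : Subgroup ↥(Subgroup.centralizer ({gprimeTorus L α S p} : Set ↥(arch (↥(maximalRealSubfield L)) L (IsCMField.complexConj L) 3 (Matrix.diagonal α)))))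
      (e : ↥(Subgroup.centralizer ({gprimeTorus L α S p} : Set ↥(arch (↥(maximalRealSubfield L)) L (IsCMField.complexConj L) 3 (Matrix.diagonal α)))) ≃ₜ*
        ↥(unitaryGroupOfForm (starRingEnd ℂ) ((Matrix.diagonal ![α (lineOf (formSign L α w₀) 0), α (lineOf (formSign L α w₀) 2)]).map w₀.1.embedding)) × ↥K)
      (φ : ↥(unitaryGroupOfForm (starRingEnd ℂ) ((Matrix.diagonal ![α (lineOf (formSign L α w₀) 0), α (lineOf (formSign L α w₀) 2)]).map w₀.1.embedding)) ≃ₜ*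
        ↥(unitaryGroupOfForm (starRingEnd ℂ) J))
      (e' : ↥(Subgroup.centralizer ({gprimeTorus L α S p} : Set ↥(arch (↥(maximalRealSubfield L)) L (IsCMField.complexConj L) 3 (Matrix.diagonal α)))) ≃ₜ*
        ↥(unitaryGroupOfForm (starRingEnd ℂ) J) × ↥K)
      (Ψ' : ↥(Subgroup.centralizer ({gprimeTorus L α S p} : Set ↥(arch (↥(maximalRealSubfield L)) L (IsCMField.complexConj L) 3 (Matrix.diagonal α)))) ⧸
          (chartTorusG L α S).subgroupOf (Subgroup.centralizer ({gprimeTorus L α S p} : Set ↥(arch (↥(maximalRealSubfield L)) L (IsCMField.complexConj L) 3 (Matrix.diagonal α)))) ≃ₜ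
        ↥(unitaryGroupOfForm (starRingEnd ℂ) J) ⧸
          Subgroup.map (φ : ↥(unitaryGroupOfForm (starRingEnd ℂ) ((Matrix.diagonal ![α (lineOf (formSign L α w₀) 0), α (lineOf (formSign L α w₀) 2)]).map w₀.1.embedding)) →*
              ↥(unitaryGroupOfForm (starRingEnd ℂ) J))
            ((circleDiagonal 2).codRestrict (unitaryGroupOfForm (starRingEnd ℂ) ((Matrix.diagonal ![α (lineOf (formSign L α w₀) 0), α (lineOf (formSign L α w₀) 2)]).map w₀.1.embedding))
              (circleDiagonal_mem_archLocal_diagonal L 2 ![α (lineOf (formSign L α w₀) 0), α (lineOf (formSign L α w₀) 2)] w₀)).range),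
      -- [1]–[3] the spectator group
      IsClosed (K : Set ↥(Subgroup.centralizer ({gprimeTorus L α S p} : Set ↥(arch (↥(maximalRealSubfield L)) L (IsCMField.complexConj L) 3 (Matrix.diagonal α))))) ∧
      (∀ k : ↥(Subgroup.centralizer ({gprimeTorus L α S p} : Set ↥(arch (↥(maximalRealSubfield L)) L (IsCMField.complexConj L) 3 (Matrix.diagonal α)))),
        k ∈ K → (k : ↥(arch (↥(maximalRealSubfield L)) L (IsCMField.complexConj L) 3 (Matrix.diagonal α))) ∈ chartTorusG L α S) ∧
      (∀ k₁, k₁ ∈ K → ∀ k₂, k₂ ∈ K → k₁ * k₂ = k₂ * k₁) ∧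
      -- [4]–[7] the (M-UNFOLD) clauses for `e`
      (∀ g : ↥(Subgroup.centralizer ({gprimeTorus L α S p} : Set ↥(arch (↥(maximalRealSubfield L)) L (IsCMField.complexConj L) 3 (Matrix.diagonal α)))),
        (g : ↥(arch (↥(maximalRealSubfield L)) L (IsCMField.complexConj L) 3 (Matrix.diagonal α))) ∈ chartTorusG L α S ↔
        (((e g).1 : ↥(unitaryGroupOfForm (starRingEnd ℂ) ((Matrix.diagonal ![α (lineOf (formSign L α w₀) 0), α (lineOf (formSign L α w₀) 2)]).map w₀.1.embedding))) :
          GL (Fin 2) ℂ) ∈ Set.range (circleDiagonal 2)) ∧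
      (∀ c : {w : InfinitePlace L // IsComplex w} → Fin 3 → ℝ,
        (((e ⟨gprimeTorus L α S c, gprimeTorus_mem_centralizer L α S p c⟩).1 :
          ↥(unitaryGroupOfForm (starRingEnd ℂ) ((Matrix.diagonal ![α (lineOf (formSign L α w₀) 0), α (lineOf (formSign L α w₀) 2)]).map w₀.1.embedding))) : GL (Fin 2) ℂ) =
          circleDiagonal 2 ![Circle.exp (c w₀ 0), Circle.exp (c w₀ 2)]) ∧
      (∀ c : {w : InfinitePlace L // IsComplex w} → Fin 3 → ℝ,
        ((((e ⟨gprimeTorus L α S c, gprimeTorus_mem_centralizer L α S p c⟩).2 : ↥K) :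
          ↥(Subgroup.centralizer ({gprimeTorus L α S p} : Set ↥(arch (↥(maximalRealSubfield L)) L (IsCMField.complexConj L) 3 (Matrix.diagonal α))))) :
            ↥(arch (↥(maximalRealSubfield L)) L (IsCMField.complexConj L) 3 (Matrix.diagonal α))) =
          gprimeTorus L α S (Function.update c w₀ ![0, c w₀ 1, 0])) ∧
      Subgroup.map (e : ↥(Subgroup.centralizer ({gprimeTorus L α S p} : Set ↥(arch (↥(maximalRealSubfield L)) L (IsCMField.complexConj L) 3 (Matrix.diagonal α)))) →*
          ↥(unitaryGroupOfForm (starRingEnd ℂ) ((Matrix.diagonal ![α (lineOf (formSign L α w₀) 0), α (lineOf (formSign L α w₀) 2)]).map w₀.1.embedding)) × ↥K)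
        ((chartTorusG L α S).subgroupOf (Subgroup.centralizer ({gprimeTorus L α S p} : Set ↥(arch (↥(maximalRealSubfield L)) L (IsCMField.complexConj L) 3 (Matrix.diagonal α))))) =
        (((circleDiagonal 2).codRestrict (unitaryGroupOfForm (starRingEnd ℂ) ((Matrix.diagonal ![α (lineOf (formSign L α w₀) 0), α (lineOf (formSign L α w₀) 2)]).map w₀.1.embedding))
            (circleDiagonal_mem_archLocal_diagonal L 2 ![α (lineOf (formSign L α w₀) 0), α (lineOf (formSign L α w₀) 2)] w₀)).range).prod ⊤ ∧
      -- (B-STD): the torus clause (i) and the value formula for `φ`, and the composite `e′`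
      (∀ u : Fin 2 → Circle,
        φ ⟨circleDiagonal 2 u, circleDiagonal_mem_unitaryGroupOfForm_diagonal_map_weights w₀.1.embedding ![α (lineOf (formSign L α w₀) 0), α (lineOf (formSign L α w₀) 2)] u⟩ =
          ⟨Matrix.GeneralLinearGroup.mkOfDetNeZero !![(1 : ℂ), 1; 1, -1] det_cayleyTwo_ne_zero * circleDiagonal 2 u *
              (Matrix.GeneralLinearGroup.mkOfDetNeZero !![(1 : ℂ), 1; 1, -1] det_cayleyTwo_ne_zero)⁻¹,
            cayley_conj_circleDiagonal_mem_of_eq_over hJ u⟩) ∧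
      (∀ h : ↥(unitaryGroupOfForm (starRingEnd ℂ) ((Matrix.diagonal ![α (lineOf (formSign L α w₀) 0), α (lineOf (formSign L α w₀) 2)]).map w₀.1.embedding)),
        ((φ h : ↥(unitaryGroupOfForm (starRingEnd ℂ) J)) : GL (Fin 2) ℂ) =
          Matrix.GeneralLinearGroup.mkOfDetNeZero !![(1 : ℂ), 1; 1, -1] det_cayleyTwo_ne_zero *
            Matrix.GeneralLinearGroup.mkOfDetNeZero
              (Matrix.diagonal ![((Real.sqrt (|(w₀.1.embedding (![α (lineOf (formSign L α w₀) 0), α (lineOf (formSign L α w₀) 2)] 0)).re| / 2) : ℝ) : ℂ),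
                ((Real.sqrt (|(w₀.1.embedding (![α (lineOf (formSign L α w₀) 0), α (lineOf (formSign L α w₀) 2)] 1)).re| / 2) : ℝ) : ℂ)])
              (det_blockScale_ne_zero _ _ hsgn) * (h : GL (Fin 2) ℂ) *
          (Matrix.GeneralLinearGroup.mkOfDetNeZero !![(1 : ℂ), 1; 1, -1] det_cayleyTwo_ne_zero *
            Matrix.GeneralLinearGroup.mkOfDetNeZero
              (Matrix.diagonal ![((Real.sqrt (|(w₀.1.embedding (![α (lineOf (formSign L α w₀) 0), α (lineOf (formSign L α w₀) 2)] 0)).re| / 2) : ℝ) : ℂ),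
                ((Real.sqrt (|(w₀.1.embedding (![α (lineOf (formSign L α w₀) 0), α (lineOf (formSign L α w₀) 2)] 1)).re| / 2) : ℝ) : ℂ)])
              (det_blockScale_ne_zero _ _ hsgn))⁻¹) ∧
      (∀ g, e' g = (φ (e g).1, (e g).2)) ∧
      -- the standardised torus bookkeeping and the quotient homeomorphism
      Subgroup.map (e' : ↥(Subgroup.centralizer ({gprimeTorus L α S p} : Set ↥(arch (↥(maximalRealSubfield L)) L (IsCMField.complexConj L) 3 (Matrix.diagonal α)))) →*
          ↥(unitaryGroupOfForm (starRingEnd ℂ) J) × ↥K)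
        ((chartTorusG L α S).subgroupOf (Subgroup.centralizer ({gprimeTorus L α S p} : Set ↥(arch (↥(maximalRealSubfield L)) L (IsCMField.complexConj L) 3 (Matrix.diagonal α))))) =
        (Subgroup.map (φ : ↥(unitaryGroupOfForm (starRingEnd ℂ) ((Matrix.diagonal ![α (lineOf (formSign L α w₀) 0), α (lineOf (formSign L α w₀) 2)]).map w₀.1.embedding)) →*
              ↥(unitaryGroupOfForm (starRingEnd ℂ) J))
            ((circleDiagonal 2).codRestrict (unitaryGroupOfForm (starRingEnd ℂ) ((Matrix.diagonal ![α (lineOf (formSign L α w₀) 0), α (lineOf (formSign L α w₀) 2)]).map w₀.1.embedding))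
              (circleDiagonal_mem_archLocal_diagonal L 2 ![α (lineOf (formSign L α w₀) 0), α (lineOf (formSign L α w₀) 2)] w₀)).range).prod ⊤ ∧
      (∀ g : ↥(Subgroup.centralizer ({gprimeTorus L α S p} : Set ↥(arch (↥(maximalRealSubfield L)) L (IsCMField.complexConj L) 3 (Matrix.diagonal α)))),
        (g : ↥(arch (↥(maximalRealSubfield L)) L (IsCMField.complexConj L) 3 (Matrix.diagonal α))) ∈ chartTorusG L α S ↔
        (e' g).1 ∈ Subgroup.map (φ : ↥(unitaryGroupOfForm (starRingEnd ℂ) ((Matrix.diagonal ![α (lineOf (formSign L α w₀) 0), α (lineOf (formSign L α w₀) 2)]).map w₀.1.embedding)) →*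
              ↥(unitaryGroupOfForm (starRingEnd ℂ) J))
            ((circleDiagonal 2).codRestrict (unitaryGroupOfForm (starRingEnd ℂ) ((Matrix.diagonal ![α (lineOf (formSign L α w₀) 0), α (lineOf (formSign L α w₀) 2)]).map w₀.1.embedding))
              (circleDiagonal_mem_archLocal_diagonal L 2 ![α (lineOf (formSign L α w₀) 0), α (lineOf (formSign L α w₀) 2)] w₀)).range) ∧
      (∀ g : ↥(Subgroup.centralizer ({gprimeTorus L α S p} : Set ↥(arch (↥(maximalRealSubfield L)) L (IsCMField.complexConj L) 3 (Matrix.diagonal α)))),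
        Ψ' (QuotientGroup.mk g) = QuotientGroup.mk (e' g).1) ∧
      (∀ b : ↥(unitaryGroupOfForm (starRingEnd ℂ) J), Ψ'.symm (QuotientGroup.mk b) = QuotientGroup.mk (e'.symm (b, 1))) ∧
      IsCompact ((Subgroup.map (φ : ↥(unitaryGroupOfForm (starRingEnd ℂ) ((Matrix.diagonal ![α (lineOf (formSign L α w₀) 0), α (lineOf (formSign L α w₀) 2)]).map w₀.1.embedding)) →*
              ↥(unitaryGroupOfForm (starRingEnd ℂ) J))
            ((circleDiagonal 2).codRestrict (unitaryGroupOfForm (starRingEnd ℂ) ((Matrix.diagonal ![α (lineOf (formSign L α w₀) 0), α (lineOf (formSign L α w₀) 2)]).map w₀.1.embedding))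
              (circleDiagonal_mem_archLocal_diagonal L 2 ![α (lineOf (formSign L α w₀) 0), α (lineOf (formSign L α w₀) 2)] w₀)).range : Subgroup ↥(unitaryGroupOfForm (starRingEnd ℂ) J)) :
          Set ↥(unitaryGroupOfForm (starRingEnd ℂ) J)) := by
  -- NOTE (elaboration budget): the existentials are opened with `Exists.elim` in term mode and the conjunctions read by projections — `rcases`∕`obtain` would re-elaborate
  -- this large goal as the motive of every nested `casesOn`.
  refine (exists_continuousMulEquiv_centralizer_gprimeTorus_semireg L α S w₀ hα hS hw₀ p h02 h01 hreg hregS).elim fun K hK => hK.elim fun e he => ?_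
  refine (exists_continuousMulEquiv_prod_std (L := L) w₀.1.embedding ![α (lineOf (formSign L α w₀) 0), α (lineOf (formSign L α w₀) 2)] hreal2 hsgn hJ e).elim
    fun φ hφ => hφ.elim fun e' hY => ?_
  -- the standardised torus bookkeeping
  have hmapT' := map_prodMap_eq_of_map_eq_prod_top _ _ e φ e' hY.1 he.2.2.2.2.2.2
  -- the quotient homeomorphism (★ PART 2's generic lemma at `e′`)
  refine (exists_quotient_homeomorph_of_map_eq_prod_top _ _ e' hmapT').elim fun Ψ' hZ => ?_
  -- the Cayley torus is the continuous image of the compact torus `(S¹)²`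
  have hc : Continuous fun u : Fin 2 → Circle =>
      φ (((circleDiagonal 2).codRestrict (unitaryGroupOfForm (starRingEnd ℂ) ((Matrix.diagonal ![α (lineOf (formSign L α w₀) 0), α (lineOf (formSign L α w₀) 2)]).map w₀.1.embedding))
          (circleDiagonal_mem_archLocal_diagonal L 2 ![α (lineOf (formSign L α w₀) 0), α (lineOf (formSign L α w₀) 2)] w₀)) u) :=
    φ.continuous.comp ((continuous_circleDiagonal 2).subtype_mk _)
  have hcpt : IsCompact ((Subgroup.map (φ : ↥(unitaryGroupOfForm (starRingEnd ℂ) ((Matrix.diagonal ![α (lineOf (formSign L α w₀) 0), α (lineOf (formSign L α w₀) 2)]).map w₀.1.embedding)) →*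
              ↥(unitaryGroupOfForm (starRingEnd ℂ) J))
            ((circleDiagonal 2).codRestrict (unitaryGroupOfForm (starRingEnd ℂ) ((Matrix.diagonal ![α (lineOf (formSign L α w₀) 0), α (lineOf (formSign L α w₀) 2)]).map w₀.1.embedding))
              (circleDiagonal_mem_archLocal_diagonal L 2 ![α (lineOf (formSign L α w₀) 0), α (lineOf (formSign L α w₀) 2)] w₀)).range : Subgroup ↥(unitaryGroupOfForm (starRingEnd ℂ) J)) :
          Set ↥(unitaryGroupOfForm (starRingEnd ℂ) J)) := by
    convert isCompact_range hc using 1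
    ext x
    constructor
    · rintro ⟨y, ⟨u, rfl⟩, rfl⟩
      exact ⟨u, rfl⟩
    · rintro ⟨u, rfl⟩
      exact ⟨_, ⟨u, rfl⟩, rfl⟩
  have hmem : ∀ g : ↥(Subgroup.centralizer ({gprimeTorus L α S p} : Set ↥(arch (↥(maximalRealSubfield L)) L (IsCMField.complexConj L) 3 (Matrix.diagonal α)))),
      (g : ↥(arch (↥(maximalRealSubfield L)) L (IsCMField.complexConj L) 3 (Matrix.diagonal α))) ∈ chartTorusG L α S ↔
      (e' g).1 ∈ Subgroup.map (φ : ↥(unitaryGroupOfForm (starRingEnd ℂ) ((Matrix.diagonal ![α (lineOf (formSign L α w₀) 0), α (lineOf (formSign L α w₀) 2)]).map w₀.1.embedding)) →*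
            ↥(unitaryGroupOfForm (starRingEnd ℂ) J))
          ((circleDiagonal 2).codRestrict (unitaryGroupOfForm (starRingEnd ℂ) ((Matrix.diagonal ![α (lineOf (formSign L α w₀) 0), α (lineOf (formSign L α w₀) 2)]).map w₀.1.embedding))
            (circleDiagonal_mem_archLocal_diagonal L 2 ![α (lineOf (formSign L α w₀) 0), α (lineOf (formSign L α w₀) 2)] w₀)).range := fun g => by
    rw [← Subgroup.mem_subgroupOf]
    exact mem_iff_fst_mem_of_map_eq_prod_top _ _ e' hmapT' g
  exact ⟨K, e, φ, e', Ψ', he.1, he.2.1, he.2.2.1, he.2.2.2.1, he.2.2.2.2.1, he.2.2.2.2.2.1, he.2.2.2.2.2.2, hY.2.1, hY.2.2, hY.1, hmapT', hmem, hZ.1, hZ.2, hcpt⟩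

end Std

/-! ## §3 (ED. 2) The standardisation package IN BINDER FORM over any block splitting `e : G ≃ₜ* B_{w₀} × K` (so that ONE `e′` serves ★ p850446's, ★ p850544's and the Cayley [7β] clauses alike) -/

section StdGeneric

variable (L : Type) [Field L] (α : Fin 3 → L) (w₀ : {w : InfinitePlace L // IsComplex w})
  {J : Matrix (Fin 2) (Fin 2) ℂ} (hJ : J = (StdForm.antidiagonal 2).over ℂ)
  {G : Type*} [Group G] [TopologicalSpace G]

/-- **(B-STD) PACKAGE OVER AN ABSTRACT BLOCK SPLITTING.**  For the diagonal block `B_{w₀} = U(σ_{w₀} diag(α_{τ0}, α_{τ2}))(ℂ)` with real weights of opposite signs, ANY topological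
groups `G`, `K`, any `e : G ≃ₜ* B_{w₀} × K` and any `T ≤ G`, `A ≤ B_{w₀}` with `e(T) = A × ⊤`: there are the (B-STD) standardisation `φ : B_{w₀} ≃ₜ* U(J)` (torus clause (i), value
formula — ★ p850476), the composite `e′ : G ≃ₜ* U(J) × K` with `e′ g = (φ (e g).1, (e g).2)` (★ p850488), `e′(T) = φ(A) × ⊤`, the membership reading `g ∈ T ↔ (e′ g).1 ∈ φ(A)`, and a
quotient homeomorphism `Ψ′ : G ⧸ T ≃ₜ U(J) ⧸ φ(A)` with `Ψ′⟦g⟧ = ⟦(e′ g).1⟧`, `Ψ′⁻¹⟦b⟧ = ⟦e′⁻¹(b, 1)⟧` (★ p850477's generic lemma).  (Use with `G := ↥Z(γ_p)`, `T := T′` or `T♯′`, and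
the `e` of whichever ★ (M-UNFOLD) edition carries the clauses needed.) [cite: PlatonovRapinchuk1994, §2.3] [cite: Folland1995, §2.6] [cite: Rogawski1990, §8.2 p. 122] -/
theorem exists_std_package
    (hreal2 : ∀ i : Fin 2, (w₀.1.embedding (![α (lineOf (formSign L α w₀) 0), α (lineOf (formSign L α w₀) 2)] i)).im = 0)
    (hsgn : (w₀.1.embedding (![α (lineOf (formSign L α w₀) 0), α (lineOf (formSign L α w₀) 2)] 0)).re *
      (w₀.1.embedding (![α (lineOf (formSign L α w₀) 0), α (lineOf (formSign L α w₀) 2)] 1)).re < 0)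
    {K : Type*} [Group K] [TopologicalSpace K] [ContinuousMul K]
    (e : G ≃ₜ* ↥(unitaryGroupOfForm (starRingEnd ℂ) ((Matrix.diagonal ![α (lineOf (formSign L α w₀) 0), α (lineOf (formSign L α w₀) 2)]).map w₀.1.embedding)) × K)
    (T : Subgroup G) (A : Subgroup ↥(unitaryGroupOfForm (starRingEnd ℂ) ((Matrix.diagonal ![α (lineOf (formSign L α w₀) 0), α (lineOf (formSign L α w₀) 2)]).map w₀.1.embedding)))
    (hmapT : Subgroup.map (e : G →* ↥(unitaryGroupOfForm (starRingEnd ℂ) ((Matrix.diagonal ![α (lineOf (formSign L α w₀) 0), α (lineOf (formSign L α w₀) 2)]).map w₀.1.embedding)) × K) T =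
      A.prod ⊤) :
    ∃ (φ : ↥(unitaryGroupOfForm (starRingEnd ℂ) ((Matrix.diagonal ![α (lineOf (formSign L α w₀) 0), α (lineOf (formSign L α w₀) 2)]).map w₀.1.embedding)) ≃ₜ*
        ↥(unitaryGroupOfForm (starRingEnd ℂ) J))
      (e' : G ≃ₜ* ↥(unitaryGroupOfForm (starRingEnd ℂ) J) × K)
      (Ψ' : G ⧸ T ≃ₜ ↥(unitaryGroupOfForm (starRingEnd ℂ) J) ⧸
        Subgroup.map (φ : ↥(unitaryGroupOfForm (starRingEnd ℂ) ((Matrix.diagonal ![α (lineOf (formSign L α w₀) 0), α (lineOf (formSign L α w₀) 2)]).map w₀.1.embedding)) →*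
          ↥(unitaryGroupOfForm (starRingEnd ℂ) J)) A),
      (∀ u : Fin 2 → Circle,
        φ ⟨circleDiagonal 2 u, circleDiagonal_mem_unitaryGroupOfForm_diagonal_map_weights w₀.1.embedding ![α (lineOf (formSign L α w₀) 0), α (lineOf (formSign L α w₀) 2)] u⟩ =
          ⟨Matrix.GeneralLinearGroup.mkOfDetNeZero !![(1 : ℂ), 1; 1, -1] det_cayleyTwo_ne_zero * circleDiagonal 2 u *
              (Matrix.GeneralLinearGroup.mkOfDetNeZero !![(1 : ℂ), 1; 1, -1] det_cayleyTwo_ne_zero)⁻¹,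
            cayley_conj_circleDiagonal_mem_of_eq_over hJ u⟩) ∧
      (∀ h : ↥(unitaryGroupOfForm (starRingEnd ℂ) ((Matrix.diagonal ![α (lineOf (formSign L α w₀) 0), α (lineOf (formSign L α w₀) 2)]).map w₀.1.embedding)),
        ((φ h : ↥(unitaryGroupOfForm (starRingEnd ℂ) J)) : GL (Fin 2) ℂ) =
          Matrix.GeneralLinearGroup.mkOfDetNeZero !![(1 : ℂ), 1; 1, -1] det_cayleyTwo_ne_zero *
            Matrix.GeneralLinearGroup.mkOfDetNeZero
              (Matrix.diagonal ![((Real.sqrt (|(w₀.1.embedding (![α (lineOf (formSign L α w₀) 0), α (lineOf (formSign L α w₀) 2)] 0)).re| / 2) : ℝ) : ℂ),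
                ((Real.sqrt (|(w₀.1.embedding (![α (lineOf (formSign L α w₀) 0), α (lineOf (formSign L α w₀) 2)] 1)).re| / 2) : ℝ) : ℂ)])
              (det_blockScale_ne_zero _ _ hsgn) * (h : GL (Fin 2) ℂ) *
          (Matrix.GeneralLinearGroup.mkOfDetNeZero !![(1 : ℂ), 1; 1, -1] det_cayleyTwo_ne_zero *
            Matrix.GeneralLinearGroup.mkOfDetNeZero
              (Matrix.diagonal ![((Real.sqrt (|(w₀.1.embedding (![α (lineOf (formSign L α w₀) 0), α (lineOf (formSign L α w₀) 2)] 0)).re| / 2) : ℝ) : ℂ),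
                ((Real.sqrt (|(w₀.1.embedding (![α (lineOf (formSign L α w₀) 0), α (lineOf (formSign L α w₀) 2)] 1)).re| / 2) : ℝ) : ℂ)])
              (det_blockScale_ne_zero _ _ hsgn))⁻¹) ∧
      (∀ g, e' g = (φ (e g).1, (e g).2)) ∧
      Subgroup.map (e' : G →* ↥(unitaryGroupOfForm (starRingEnd ℂ) J) × K) T =
        (Subgroup.map (φ : ↥(unitaryGroupOfForm (starRingEnd ℂ) ((Matrix.diagonal ![α (lineOf (formSign L α w₀) 0), α (lineOf (formSign L α w₀) 2)]).map w₀.1.embedding)) →*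
          ↥(unitaryGroupOfForm (starRingEnd ℂ) J)) A).prod ⊤ ∧
      (∀ g : G, g ∈ T ↔ (e' g).1 ∈ Subgroup.map (φ : ↥(unitaryGroupOfForm (starRingEnd ℂ) ((Matrix.diagonal ![α (lineOf (formSign L α w₀) 0), α (lineOf (formSign L α w₀) 2)]).map w₀.1.embedding)) →*
          ↥(unitaryGroupOfForm (starRingEnd ℂ) J)) A) ∧
      (∀ g : G, Ψ' (QuotientGroup.mk g) = QuotientGroup.mk (e' g).1) ∧
      (∀ b : ↥(unitaryGroupOfForm (starRingEnd ℂ) J), Ψ'.symm (QuotientGroup.mk b) = QuotientGroup.mk (e'.symm (b, 1))) := by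
  refine (exists_continuousMulEquiv_prod_std (L := L) w₀.1.embedding ![α (lineOf (formSign L α w₀) 0), α (lineOf (formSign L α w₀) 2)] hreal2 hsgn hJ e).elim
    fun φ hφ => hφ.elim fun e' hY => ?_
  have hmapT' := map_prodMap_eq_of_map_eq_prod_top T A e φ e' hY.1 hmapT
  refine (exists_quotient_homeomorph_of_map_eq_prod_top T _ e' hmapT').elim fun Ψ' hZ => ?_
  exact ⟨φ, e', Ψ', hY.2.1, hY.2.2, hY.1, hmapT', fun g => mem_iff_fst_mem_of_map_eq_prod_top T _ e' hmapT' g, hZ.1, hZ.2⟩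

/-- The Cayley torus `φ(A_{w₀})`, `A_{w₀}` the unit-diagonal torus of the block, is COMPACT (continuous image of `(S¹)²`), for ANY continuous `φ`. [cite: Folland1995, §2.6] -/
theorem isCompact_map_circleDiagonal_range {U : Type*} [Group U] [TopologicalSpace U]
    (φ : ↥(unitaryGroupOfForm (starRingEnd ℂ) ((Matrix.diagonal ![α (lineOf (formSign L α w₀) 0), α (lineOf (formSign L α w₀) 2)]).map w₀.1.embedding)) ≃ₜ* U) :
    IsCompact ((Subgroup.map (φ : ↥(unitaryGroupOfForm (starRingEnd ℂ) ((Matrix.diagonal ![α (lineOf (formSign L α w₀) 0), α (lineOf (formSign L α w₀) 2)]).map w₀.1.embedding)) →* U)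
        ((circleDiagonal 2).codRestrict (unitaryGroupOfForm (starRingEnd ℂ) ((Matrix.diagonal ![α (lineOf (formSign L α w₀) 0), α (lineOf (formSign L α w₀) 2)]).map w₀.1.embedding))
          (circleDiagonal_mem_archLocal_diagonal L 2 ![α (lineOf (formSign L α w₀) 0), α (lineOf (formSign L α w₀) 2)] w₀)).range : Subgroup U) : Set U) := by
  have hc : Continuous fun u : Fin 2 → Circle =>
      φ (((circleDiagonal 2).codRestrict (unitaryGroupOfForm (starRingEnd ℂ) ((Matrix.diagonal ![α (lineOf (formSign L α w₀) 0), α (lineOf (formSign L α w₀) 2)]).map w₀.1.embedding))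
          (circleDiagonal_mem_archLocal_diagonal L 2 ![α (lineOf (formSign L α w₀) 0), α (lineOf (formSign L α w₀) 2)] w₀)) u) :=
    φ.continuous.comp ((continuous_circleDiagonal 2).subtype_mk _)
  convert isCompact_range hc using 1
  ext x
  constructor
  · rintro ⟨y, ⟨u, rfl⟩, rfl⟩
    exact ⟨u, rfl⟩
  · rintro ⟨u, rfl⟩
    exact ⟨_, ⟨u, rfl⟩, rfl⟩

end StdGeneric

end Literature.NumberTheory.Rogawski1990

end
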